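import Summits.HodgeConjecture.HodgeConjecture.Theorems.SixfoldTableXCensusWeilCentralKGeneral
import Literature.AlgebraicGeometry.HodgeTheory.WeilTypeSixfoldHodgeGroupSUOfLie
import HarnessLib

/-!
# TABLE X (dimension 6) — the Weil-type rows with `End⁰ = K` EXACTLY (row 9 `g6.Weil.k.(3,3)`, all members): the census
# nodes X2 / X1 and the «HC ⟸ {Markman₆, R-W6}» corollaries RE-KEYED from the displayed GROUP hypothesis `hG` /
# `HasHodgeGroupSU` to the displayed LIE hypothesis `hSU` (cell `pub-hodgeav-hg6`, req-37 (A) Q2b; eng-3 g3, B5b;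
# lead g3 2026-08-29T03:42:31Z)

HONEST FRAMING. HC, `HC_AV` (stmt-1333), `HC_CM` (stmt-3052) and H2 are NOT proved and do not occur. X2 / X1 stay
`@[conjecture]` (OURS); R-W6, Markman₆ and `WeilSixfolds` appear only as displayed hypotheses of the HC corollaries; the Lie
hypothesis `hSU` («every `φ_ℂ`-commuting `ψ_ℂ`-skew operator with trace `0` on `W = ker(φ_ℂ − i√d)` lies in
`Lie Hg(H¹A) ⊗ ℂ`», for every polarization `ψ` of `H¹(A(ℂ); ℚ)` — the conclusion of brick B4′ = S4 of the (3|3) Weil square,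
NOT yet a tree theorem) is DISPLAYED verbatim on every theorem, so that S4 discharges it by `fun ψ ↦ B4′ hW hE2 ψ`.
KERNEL ONLY: theorems over existing declarations; no definition, no `sorry`, no named fact; restates nothing.

WHY THIS MODULE. The census files `SixfoldTableXCensusWeilCentralKGeneral` (W1G wrapper: `TableX.WeilERows.census_weilType_detOne_general`,
`…_of_isIsogenous`, `hodgeConjectureFor_weilType_detOne_general_of_weilSixfolds` / `_of_markman₆_nonsplit` /
`hodgeConjectureFor_of_isIsogenous_…`) and `SixfoldTableXCensusWeilGeneralRow` (L12: `TableX.WeilRows.census_row9_generalWeil`,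
`…_of_isIsogenous`, `hodgeConjectureFor_generalWeilSixfold_of_weilSixfolds` / `_of_markman₆_nonsplit` / `…_of_isIsogenous_…`)
display the GROUP-LEVEL general-member hypothesis — `hG : ∀ u ∈ S(A)(h)(ℂ), det(u | W) = 1 → u ∈ Hg(A)(ℂ)|_{H¹}`, resp. van
Geemen's `HasHodgeGroupSU A φ 3 d h_K`. For the members with `End⁰(A) = K` EXACTLY (`finrank_ℚ End⁰(A) = 2`) the Literature
brick B5a `HodgeTheory/WeilTypeSixfoldHodgeGroupSUOfLie` (this seat) derives both from the Lie hypothesis `hSU`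
(`IsWeilType.mem_hodgeGroupOne_of_mem_unitaryCentralizerGroup_of_hodgeLieC`, `IsWeilType.hasHodgeGroupSU_ksymm_of_hodgeLieC`:
Deligne's rigidity + unipotent generation of `SL(W)` inside the word model). This file is the one-line-per-theorem
re-keying; `hφC` (`φ^*` central in `C(A) ⊗ ℂ`) is DISCHARGED from `End⁰ = K`
(`pullbackOne_mem_adjoin_of_finrank_endAlgebra_eq_two`), the other binders (hdom / hh / hnd / hφQ / the HC residues) are kept
as the rows display them. When S4 lands, `hSU` is discharged row by row (B5c); until then every statement here is
CONDITIONAL on the displayed `hSU`. Rows 11 / 13 (`End⁰ = E ⊋ K`) are OUT of scope (they keep `hG`).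

* §0 `pullbackOne_mem_centralizerAlgebra_of_finrank_endAlgebra_eq_two` — `End⁰ = K ⟹ φ^* ∈ C(A) ⊗ ℂ`.
* §1 **`census_weilType_endK_ofLie`** (+ `_of_isIsogenous`) — W1G's verdict `(dim A = 6 ∧ ¬ 𝒞 A) ∧` X2-at-`A` `∧` X1-at-`A`
  for `(A, φ)` of Weil type `(3, d)`, `End⁰ = K`, `h ∈ B¹ ⊗ ℂ` with `Q_h` non-degenerate and `φ^*` a `d`-similitude, MODULO `hSU`.
* §2 `hodgeConjectureFor_weilType_endK_ofLie_of_weilSixfolds` / `_of_markman₆_nonsplit` / `…_of_isIsogenous_…` — W1G §2 re-keyed.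
* §3 **`census_row9_ksymm_ofLie`** (+ `_of_isIsogenous`), `hodgeConjectureFor_row9_ksymm_ofLie_of_weilSixfolds` /
  `_of_markman₆_nonsplit` / `…_of_isIsogenous_…` — L12 re-keyed through `HasHodgeGroupSU A φ 3 d h_K ⟸ hSU`.

All declarations in the sub-namespace `TableX.WeilLieRows`. Nothing here is a corollary of `HC_CM`; typed ≠ proved.
-/

set_option linter.dupNamespace false

noncomputable section

open scoped TensorProduct
open CategoryTheory
open Literature.AlgebraicGeometry Literature.AlgebraicGeometry.Motives
open Literature.AlgebraicGeometry.Motives.AbelianVariety (IsIsogenous IsSimple)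
open Literature.AlgebraicGeometry.Motives.HodgeStructure
open Literature.AlgebraicGeometry.HodgeTheory
open Literature.AlgebraicGeometry.Milne1999
open Literature.AlgebraicGeometry.VanGeemen1994 (pullbackOne hodgeGroupOne detOnEigenspace hK)
open Literature.AlgebraicTopology.SingularHomology
open Literature.Barriers.HodgeConjecture
open Summit.HodgeConjecture.HodgeConjecture.Ring2.ClassTargets
open Summit.HodgeConjecture.HodgeConjecture.Ring2.Motiv (ProdCMCell)
open Summit.HodgeConjecture.HodgeConjecture.Ring2.Atlas (IsQuarticFieldTypeIVFourfold)

namespace Summit.HodgeConjecture.HodgeConjecture.TableX.WeilLieRows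

variable (A : AbelianVariety ℂ) (φ : A ⟶ A) (d : ℕ)

/-! ## §0 `End⁰ = K` ⟹ `φ^*` is central in `C(A) ⊗ ℂ` -/

variable {A φ d} in
/-- **`End⁰(A) = K` ⟹ `φ^* ∈ C(A) ⊗ ℂ`** (the census files' binder `hφC`): every pull-back `u^*` is a polynomial in `φ^*`
(`pullbackOne_mem_adjoin_of_finrank_endAlgebra_eq_two`), hence commutes with `φ^*`. [cite: vanGeemen1994HodgeAV, 4.9 and 6.9]
[cite: Milne1999LefschetzClasses, §1 p. 642] -/
theorem pullbackOne_mem_centralizerAlgebra_of_finrank_endAlgebra_eq_two (hd : 0 < d) (hφ : φ ≫ φ = -(d • 𝟙 A))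
    (hE2 : Module.finrank ℚ A.endAlgebra = 2) (hA : 0 < A.dim) : pullbackOne A φ ∈ centralizerAlgebra A := by
  rw [mem_centralizerAlgebra_iff]
  intro u
  have hu : pullbackOne A u ∈ Subalgebra.centralizer ℂ {pullbackOne A φ} :=
    (Algebra.adjoin_le (fun x (hx : x ∈ ({pullbackOne A φ} : Set _)) ↦ by
      rw [Set.mem_singleton_iff] at hx
      rw [hx, SetLike.mem_coe, Subalgebra.mem_centralizer_iff]
      rintro _ rfl
      rfl)) (pullbackOne_mem_adjoin_of_finrank_endAlgebra_eq_two hd hφ hE2 hA u)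
  exact ((Subalgebra.mem_centralizer_iff ℂ).1 hu _ rfl).symm

/-! ## §1 `End⁰ = K` Weil carriers, every member MODULO the Lie hypothesis: both census conclusions, in the kernel -/

variable {h : complexBetti A.X 2}

/-- **TABLE X ROW 9 (`End⁰ = K`, ALL MEMBERS MODULO `hSU`), KERNEL VERDICT WITH DOMAIN MEMBERSHIP** — W1G's
`TableX.WeilERows.census_weilType_detOne_general` with its group hypothesis `hG` REPLACED by `finrank_ℚ End⁰(A) = 2` and the
displayed Lie hypothesis `hSU` (brick B4′'s conclusion, for every polarization `ψ`), `hφC` discharged: for `(A, φ)` of Weil type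
`(3, d)`, the displayed domain membership `¬ 𝒞 A`, a class `h ∈ B¹(A) ⊗ ℂ` with `Q_h` non-degenerate and `φ^*` a `d`-similitude:
`(dim A = 6 ∧ ¬ 𝒞 A) ∧` X2-at-`A` `∧` X1-at-`A` (`B² ⊆ D² ⊗ ℂ`; `B³ ⊆ D³ ⊗ ℂ ⊔ W_K ⊗ ℂ`). The bridge `hSU ⟹ hG` is
`IsWeilType.mem_hodgeGroupOne_of_mem_unitaryCentralizerGroup_of_hodgeLieC` (B5a §4). HC NOT proved; `hSU` displayed, not discharged.
[cite: Milne1999LefschetzClasses, Thm. 3.2 and Cor. 4.5] [cite: vanGeemen1994HodgeAV, Thm. 6.12 and 4.9]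
[cite: Deligne1982HodgeCycles, I §3 Prop. 3.4 and 3.6] [cite: MoonenZarhin1999LowDim, (2.3) and §3 (3.1)] -/
theorem census_weilType_endK_ofLie (hW : IsWeilType A φ 3 d) (hE2 : Module.finrank ℚ A.endAlgebra = 2)
    (hSU : haveI : HodgeTensorFacts.{0, 0} := hodgeTensorFacts_holds
      ∀ (ψ : (BettiUniverse.hodge exists_isReal_hodgeModel_holds (AbelianVariety.isSmoothProjective_holds (A := A)) 1).Polarization)
        (Y : Module.End ℂ (ℂ ⊗[ℚ] bettiCohomology A.X 1))
        (hYφ : Y * ((bettiCohomology.map φ.hom.hom.hom 1).hom).baseChange ℂ =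
          ((bettiCohomology.map φ.hom.hom.hom 1).hom).baseChange ℂ * Y),
        (∀ x y, ψ.form.baseChange ℂ (Y x) y + ψ.form.baseChange ℂ x (Y y) = 0) →
        LinearMap.trace ℂ _ (Y.restrict fun x (hx : x ∈ Module.End.eigenspace
            (((bettiCohomology.map φ.hom.hom.hom 1).hom).baseChange ℂ) (Complex.I * (Real.sqrt d : ℂ))) =>
          UnitaryTheta.apply_mem_eigenspace_of_commute hYφ hx) = 0 →
        Y ∈ (BettiUniverse.hodge exists_isReal_hodgeModel_holds (AbelianVariety.isSmoothProjective_holds (A := A)) 1).hodgeLieC)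
    (hdom : ¬ (IsOfCMType A ∨ ProdCMCell IsQuarticFieldTypeIVFourfold (fun Z ↦ Z.dim = 2) A))
    (hh : h ∈ VanGeemen1994.hodgeClassSpan A.dim A.X 1)
    (hnd : ∀ x : complexBetti A.X 1, (∀ y, polarizationPairingOne A.X h (A.dim - 1) x y = 0) → x = 0)
    (hφQ : ∀ x y, polarizationPairingOne A.X h (A.dim - 1) (pullbackOne A φ x) (pullbackOne A φ y) =
      (d : ℂ) • polarizationPairingOne A.X h (A.dim - 1) x y) :
    (A.dim = 6 ∧ ¬ (IsOfCMType A ∨ ProdCMCell IsQuarticFieldTypeIVFourfold (fun Z ↦ Z.dim = 2) A)) ∧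
    (∀ c : complexBetti A.X (2 * 2), IsRationalClass c → IsOfHodgeType A.dim A.X (2 * 2) 2 2 c →
      c ∈ divisorClassesSpan A.X A.dim 2 ⊔ Submodule.span ℂ {w' : complexBetti A.X (2 * 2) |
        ∃ (C : AbelianVariety ℂ) (g : A.X ⟶ C.X) (w : complexBetti C.X (2 * 2)), C.dim < A.dim ∧
          IsRationalClass w ∧ IsOfHodgeType C.dim C.X (2 * 2) 2 2 w ∧ w' = complexBetti.map g (2 * 2) w}) ∧
    (∀ c : complexBetti A.X (2 * 3), IsRationalClass c → IsOfHodgeType A.dim A.X (2 * 3) 3 3 c →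
      c ∈ divisorClassesSpan A.X A.dim 3 ⊔ Submodule.span ℂ {w' : complexBetti A.X (2 * 3) |
          ∃ (a : complexBetti A.X (2 * 2)) (b : complexBetti A.X (2 * 1)),
            IsRationalClass a ∧ IsOfHodgeType A.dim A.X (2 * 2) 2 2 a ∧ IsRationalClass b ∧
            IsOfHodgeType A.dim A.X (2 * 1) 1 1 b ∧ w' = cupProduct (two_mul_add_two_mul 2 1) a b} ⊔
        Submodule.span ℂ {w' : complexBetti A.X (2 * 3) |
          ∃ (C : AbelianVariety ℂ) (g : A.X ⟶ C.X) (w : complexBetti C.X (2 * 3)), C.dim < A.dim ∧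
            IsRationalClass w ∧ IsOfHodgeType C.dim C.X (2 * 3) 3 3 w ∧ w' = complexBetti.map g (2 * 3) w} ⊔
        Submodule.span ℂ {w' : complexBetti A.X (2 * 3) |
          ∃ (B' : AbelianVariety ℂ) (g : A.X ⟶ B'.X) (d : ℕ) (ψ : B' ⟶ B') (w : complexBetti B'.X (2 * 3)),
            B'.dim = 6 ∧ 0 < d ∧ ψ ≫ ψ = -(d • 𝟙 B') ∧ IsRationalClass w ∧
            IsOfHodgeType B'.dim B'.X (2 * 3) 3 3 w ∧ w ∈ weilClassesOf B' ψ 3 d ∧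
            w' = complexBetti.map g (2 * 3) w}) := by
  haveI : HodgeTensorFacts.{0, 0} := hodgeTensorFacts_holds
  obtain ⟨ψ⟩ := BettiUniverse.hodge_isPolarizable exists_isReal_hodgeModel_holds
    (AbelianVariety.isSmoothProjective_holds (A := A)) 1
  have hA : 0 < A.dim := by rw [hW.dim_eq]; norm_num
  exact WeilERows.census_weilType_detOne_general A φ d hW hdom hh hnd
    (pullbackOne_mem_centralizerAlgebra_of_finrank_endAlgebra_eq_two hW.d_pos hW.sq_eq hE2 hA) hφQ
    fun u hu hdet ↦ hW.mem_hodgeGroupOne_of_mem_unitaryCentralizerGroup_of_hodgeLieC hE2 ψ (hSU ψ) hh hnd hφQ u hu hdet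

/-- **Row 9 (`End⁰ = K`), every member modulo `hSU`, on the whole ISOGENY CLASS** (L7 `offResidueSix_iff_of_isIsogenous`,
L7b `codimTwo/ThreeCensusAt_iff_of_isIsogenous`). [cite: Milne1999LefschetzClasses, Cor. 4.5] [cite: vanGeemen1994HodgeAV, Thm. 6.12 and Lemma 3.7]
[cite: MoonenZarhin1999LowDim, §5 (5.1)] -/
theorem census_weilType_endK_ofLie_of_isIsogenous {A' : AbelianVariety ℂ} (hW : IsWeilType A φ 3 d)
    (hE2 : Module.finrank ℚ A.endAlgebra = 2)
    (hSU : haveI : HodgeTensorFacts.{0, 0} := hodgeTensorFacts_holds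
      ∀ (ψ : (BettiUniverse.hodge exists_isReal_hodgeModel_holds (AbelianVariety.isSmoothProjective_holds (A := A)) 1).Polarization)
        (Y : Module.End ℂ (ℂ ⊗[ℚ] bettiCohomology A.X 1))
        (hYφ : Y * ((bettiCohomology.map φ.hom.hom.hom 1).hom).baseChange ℂ =
          ((bettiCohomology.map φ.hom.hom.hom 1).hom).baseChange ℂ * Y),
        (∀ x y, ψ.form.baseChange ℂ (Y x) y + ψ.form.baseChange ℂ x (Y y) = 0) →
        LinearMap.trace ℂ _ (Y.restrict fun x (hx : x ∈ Module.End.eigenspace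
            (((bettiCohomology.map φ.hom.hom.hom 1).hom).baseChange ℂ) (Complex.I * (Real.sqrt d : ℂ))) =>
          UnitaryTheta.apply_mem_eigenspace_of_commute hYφ hx) = 0 →
        Y ∈ (BettiUniverse.hodge exists_isReal_hodgeModel_holds (AbelianVariety.isSmoothProjective_holds (A := A)) 1).hodgeLieC)
    (hdom : ¬ (IsOfCMType A ∨ ProdCMCell IsQuarticFieldTypeIVFourfold (fun Z ↦ Z.dim = 2) A))
    (hh : h ∈ VanGeemen1994.hodgeClassSpan A.dim A.X 1)
    (hnd : ∀ x : complexBetti A.X 1, (∀ y, polarizationPairingOne A.X h (A.dim - 1) x y = 0) → x = 0)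
    (hφQ : ∀ x y, polarizationPairingOne A.X h (A.dim - 1) (pullbackOne A φ x) (pullbackOne A φ y) =
      (d : ℂ) • polarizationPairingOne A.X h (A.dim - 1) x y)
    (hA'A : IsIsogenous A' A) :
    (A'.dim = 6 ∧ ¬ (IsOfCMType A' ∨ ProdCMCell IsQuarticFieldTypeIVFourfold (fun Z ↦ Z.dim = 2) A')) ∧
    (∀ c : complexBetti A'.X (2 * 2), IsRationalClass c → IsOfHodgeType A'.dim A'.X (2 * 2) 2 2 c →
      c ∈ divisorClassesSpan A'.X A'.dim 2 ⊔ Submodule.span ℂ {w' : complexBetti A'.X (2 * 2) |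
        ∃ (C : AbelianVariety ℂ) (g : A'.X ⟶ C.X) (w : complexBetti C.X (2 * 2)), C.dim < A'.dim ∧
          IsRationalClass w ∧ IsOfHodgeType C.dim C.X (2 * 2) 2 2 w ∧ w' = complexBetti.map g (2 * 2) w}) ∧
    (∀ c : complexBetti A'.X (2 * 3), IsRationalClass c → IsOfHodgeType A'.dim A'.X (2 * 3) 3 3 c →
      c ∈ divisorClassesSpan A'.X A'.dim 3 ⊔ Submodule.span ℂ {w' : complexBetti A'.X (2 * 3) |
          ∃ (a : complexBetti A'.X (2 * 2)) (b : complexBetti A'.X (2 * 1)),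
            IsRationalClass a ∧ IsOfHodgeType A'.dim A'.X (2 * 2) 2 2 a ∧ IsRationalClass b ∧
            IsOfHodgeType A'.dim A'.X (2 * 1) 1 1 b ∧ w' = cupProduct (two_mul_add_two_mul 2 1) a b} ⊔
        Submodule.span ℂ {w' : complexBetti A'.X (2 * 3) |
          ∃ (C : AbelianVariety ℂ) (g : A'.X ⟶ C.X) (w : complexBetti C.X (2 * 3)), C.dim < A'.dim ∧
            IsRationalClass w ∧ IsOfHodgeType C.dim C.X (2 * 3) 3 3 w ∧ w' = complexBetti.map g (2 * 3) w} ⊔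
        Submodule.span ℂ {w' : complexBetti A'.X (2 * 3) |
          ∃ (B' : AbelianVariety ℂ) (g : A'.X ⟶ B'.X) (d : ℕ) (ψ : B' ⟶ B') (w : complexBetti B'.X (2 * 3)),
            B'.dim = 6 ∧ 0 < d ∧ ψ ≫ ψ = -(d • 𝟙 B') ∧ IsRationalClass w ∧
            IsOfHodgeType B'.dim B'.X (2 * 3) 3 3 w ∧ w ∈ weilClassesOf B' ψ 3 d ∧
            w' = complexBetti.map g (2 * 3) w}) := by
  obtain ⟨hdom', h2, h3⟩ := census_weilType_endK_ofLie A φ d hW hE2 hSU hdom hh hnd hφQ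
  exact ⟨(offResidueSix_iff_of_isIsogenous hA'A).mpr hdom', (codimTwoCensusAt_iff_of_isIsogenous hA'A).mpr h2,
    (codimThreeCensusAt_iff_of_isIsogenous hA'A).mpr h3⟩

/-! ## §2 HC for the `End⁰ = K` members from the named residues, modulo the Lie hypothesis -/

/-- **HC for every `End⁰ = K` Weil-type sixfold from the ladder item `WeilSixfolds`, MODULO `hSU`** — W1G's
`hodgeConjectureFor_weilType_detOne_general_of_weilSixfolds` re-keyed (`hG ⟸ hSU`, B5a §4; `hφC` discharged). The binders
`WeilSixfolds` (stmt-HodgeConjecture-2524) and `hSU` are displayed, not asserted. [cite: vanGeemen1994HodgeAV, 2.4 and Thm. 6.12]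
[cite: Milne1999LefschetzClasses, Cor. 4.5] [cite: Deligne1982HodgeCycles, I §3 Prop. 3.4] -/
theorem hodgeConjectureFor_weilType_endK_ofLie_of_weilSixfolds (hW₆ : Theses.SevenfoldWeilCensus.WeilSixfolds)
    (hW : IsWeilType A φ 3 d) (hE2 : Module.finrank ℚ A.endAlgebra = 2)
    (hSU : haveI : HodgeTensorFacts.{0, 0} := hodgeTensorFacts_holds
      ∀ (ψ : (BettiUniverse.hodge exists_isReal_hodgeModel_holds (AbelianVariety.isSmoothProjective_holds (A := A)) 1).Polarization)
        (Y : Module.End ℂ (ℂ ⊗[ℚ] bettiCohomology A.X 1))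
        (hYφ : Y * ((bettiCohomology.map φ.hom.hom.hom 1).hom).baseChange ℂ =
          ((bettiCohomology.map φ.hom.hom.hom 1).hom).baseChange ℂ * Y),
        (∀ x y, ψ.form.baseChange ℂ (Y x) y + ψ.form.baseChange ℂ x (Y y) = 0) →
        LinearMap.trace ℂ _ (Y.restrict fun x (hx : x ∈ Module.End.eigenspace
            (((bettiCohomology.map φ.hom.hom.hom 1).hom).baseChange ℂ) (Complex.I * (Real.sqrt d : ℂ))) =>
          UnitaryTheta.apply_mem_eigenspace_of_commute hYφ hx) = 0 →
        Y ∈ (BettiUniverse.hodge exists_isReal_hodgeModel_holds (AbelianVariety.isSmoothProjective_holds (A := A)) 1).hodgeLieC)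
    (hh : h ∈ VanGeemen1994.hodgeClassSpan A.dim A.X 1)
    (hnd : ∀ x : complexBetti A.X 1, (∀ y, polarizationPairingOne A.X h (A.dim - 1) x y = 0) → x = 0)
    (hφQ : ∀ x y, polarizationPairingOne A.X h (A.dim - 1) (pullbackOne A φ x) (pullbackOne A φ y) =
      (d : ℂ) • polarizationPairingOne A.X h (A.dim - 1) x y) :
    HodgeConjectureFor A.dim A.X := by
  haveI : HodgeTensorFacts.{0, 0} := hodgeTensorFacts_holds
  obtain ⟨ψ⟩ := BettiUniverse.hodge_isPolarizable exists_isReal_hodgeModel_holds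
    (AbelianVariety.isSmoothProjective_holds (A := A)) 1
  have hA : 0 < A.dim := by rw [hW.dim_eq]; norm_num
  exact WeilERows.hodgeConjectureFor_weilType_detOne_general_of_weilSixfolds A φ d hW₆ hW hh hnd
    (pullbackOne_mem_centralizerAlgebra_of_finrank_endAlgebra_eq_two hW.d_pos hW.sq_eq hE2 hA) hφQ
    fun u hu hdet ↦ hW.mem_hodgeGroupOne_of_mem_unitaryCentralizerGroup_of_hodgeLieC hE2 ψ (hSU ψ) hh hnd hφQ u hu hdet

/-- **HC for every `End⁰ = K` Weil-type sixfold from the NAMED RESIDUES {Markman₆, R-W6}, MODULO `hSU`** — W1G's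
`hodgeConjectureFor_weilType_detOne_general_of_markman₆_nonsplit` re-keyed. Markman₆ (preprint, UNREFEREED), R-W6 (OPEN) and
`hSU` are displayed, not asserted. [cite: Markman2025SecantWeil, Thm. 1.5.1 (preprint, unrefereed)]
[claim: Markman2025SurveySecant, status: under-review] [cite: vanGeemen1994HodgeAV, Thm. 6.12] [cite: Milne1999LefschetzClasses, Cor. 4.5] -/
theorem hodgeConjectureFor_weilType_endK_ofLie_of_markman₆_nonsplit
    (hMark₆ : Markman2025_weilClasses_algebraic_hyperbolicSixfold) (hRW6 : WeilTypeLadder.NonsplitSixfolds)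
    (hW : IsWeilType A φ 3 d) (hE2 : Module.finrank ℚ A.endAlgebra = 2)
    (hSU : haveI : HodgeTensorFacts.{0, 0} := hodgeTensorFacts_holds
      ∀ (ψ : (BettiUniverse.hodge exists_isReal_hodgeModel_holds (AbelianVariety.isSmoothProjective_holds (A := A)) 1).Polarization)
        (Y : Module.End ℂ (ℂ ⊗[ℚ] bettiCohomology A.X 1))
        (hYφ : Y * ((bettiCohomology.map φ.hom.hom.hom 1).hom).baseChange ℂ =
          ((bettiCohomology.map φ.hom.hom.hom 1).hom).baseChange ℂ * Y),
        (∀ x y, ψ.form.baseChange ℂ (Y x) y + ψ.form.baseChange ℂ x (Y y) = 0) →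
        LinearMap.trace ℂ _ (Y.restrict fun x (hx : x ∈ Module.End.eigenspace
            (((bettiCohomology.map φ.hom.hom.hom 1).hom).baseChange ℂ) (Complex.I * (Real.sqrt d : ℂ))) =>
          UnitaryTheta.apply_mem_eigenspace_of_commute hYφ hx) = 0 →
        Y ∈ (BettiUniverse.hodge exists_isReal_hodgeModel_holds (AbelianVariety.isSmoothProjective_holds (A := A)) 1).hodgeLieC)
    (hh : h ∈ VanGeemen1994.hodgeClassSpan A.dim A.X 1)
    (hnd : ∀ x : complexBetti A.X 1, (∀ y, polarizationPairingOne A.X h (A.dim - 1) x y = 0) → x = 0)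
    (hφQ : ∀ x y, polarizationPairingOne A.X h (A.dim - 1) (pullbackOne A φ x) (pullbackOne A φ y) =
      (d : ℂ) • polarizationPairingOne A.X h (A.dim - 1) x y) :
    HodgeConjectureFor A.dim A.X :=
  hodgeConjectureFor_weilType_endK_ofLie_of_weilSixfolds A φ d
    (WeilTypeLadder.weilSixfolds_of_nonsplitSixfolds_of_floor hMark₆ hRW6) hW hE2 hSU hh hnd hφQ

/-- **… and on the whole isogeny class** (van Geemen Lemma 3.7 = `HodgeConjectureFor.of_isIsogenous`).
[cite: vanGeemen1994HodgeAV, Lemma 3.7 and Thm. 6.12] [cite: Markman2025SecantWeil, Thm. 1.5.1 (preprint, unrefereed)] -/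
theorem hodgeConjectureFor_of_isIsogenous_weilType_endK_ofLie_of_markman₆_nonsplit {A' : AbelianVariety ℂ}
    (hMark₆ : Markman2025_weilClasses_algebraic_hyperbolicSixfold) (hRW6 : WeilTypeLadder.NonsplitSixfolds)
    (hW : IsWeilType A φ 3 d) (hE2 : Module.finrank ℚ A.endAlgebra = 2)
    (hSU : haveI : HodgeTensorFacts.{0, 0} := hodgeTensorFacts_holds
      ∀ (ψ : (BettiUniverse.hodge exists_isReal_hodgeModel_holds (AbelianVariety.isSmoothProjective_holds (A := A)) 1).Polarization)
        (Y : Module.End ℂ (ℂ ⊗[ℚ] bettiCohomology A.X 1))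
        (hYφ : Y * ((bettiCohomology.map φ.hom.hom.hom 1).hom).baseChange ℂ =
          ((bettiCohomology.map φ.hom.hom.hom 1).hom).baseChange ℂ * Y),
        (∀ x y, ψ.form.baseChange ℂ (Y x) y + ψ.form.baseChange ℂ x (Y y) = 0) →
        LinearMap.trace ℂ _ (Y.restrict fun x (hx : x ∈ Module.End.eigenspace
            (((bettiCohomology.map φ.hom.hom.hom 1).hom).baseChange ℂ) (Complex.I * (Real.sqrt d : ℂ))) =>
          UnitaryTheta.apply_mem_eigenspace_of_commute hYφ hx) = 0 →
        Y ∈ (BettiUniverse.hodge exists_isReal_hodgeModel_holds (AbelianVariety.isSmoothProjective_holds (A := A)) 1).hodgeLieC)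
    (hh : h ∈ VanGeemen1994.hodgeClassSpan A.dim A.X 1)
    (hnd : ∀ x : complexBetti A.X 1, (∀ y, polarizationPairingOne A.X h (A.dim - 1) x y = 0) → x = 0)
    (hφQ : ∀ x y, polarizationPairingOne A.X h (A.dim - 1) (pullbackOne A φ x) (pullbackOne A φ y) =
      (d : ℂ) • polarizationPairingOne A.X h (A.dim - 1) x y)
    (hA'A : IsIsogenous A' A) : HodgeConjectureFor A'.dim A'.X :=
  HodgeConjectureFor.of_isIsogenous hA'A
    (hodgeConjectureFor_weilType_endK_ofLie_of_markman₆_nonsplit A φ d hMark₆ hRW6 hW hE2 hSU hh hnd hφQ)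

end Summit.HodgeConjecture.HodgeConjecture.TableX.WeilLieRows
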